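import Summits.KontsevichZagierPeriods.KontsevichZagierPeriods.Theorems.FurushoPentagonSectorToKernelCubeResolutionOfNash
import Summits.KontsevichZagierPeriods.KontsevichZagierPeriods.Theorems.LiftingCriteriaCubeNashNormalFormDimLeOne

/-!
# BC5 special case — `CubeResolution` (stmt-KontsevichZagierPeriods-17978) holds UNCONDITIONALLY in dimension `≤ 1`

Piece X₁ of the split of `ReductionRigidity` (stmt-3407), instance `N ≤ 1`, with NO sorry: every integral
representation of dimension `0` or `1` is congruent modulo `KZ.relations` to an element of the tame cubical
span (the statement of the item with `N ≤ 1` added).  Proof: LiftingCriteria's landed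
`CubeNashNormalFormDimLeOne.of_mem_of_dim_le_one` (Viu-Sos to bounded plane volumes, cylindrical
decomposition, Newton–Leibniz down to algebraic intervals, real Puiseux charts) applied to the subgroup
`relations ⊔ (tame span)`, into which every cube–Nash generator falls through its tame representative
(`KZ.of_sub_of_mem_relations_of_eqOn`).  Shows the definitions compute and the crux is inhabited-in-kind.
-/

noncomputable section

-- `Summit.KontsevichZagierPeriods.KontsevichZagierPeriods.…` is the tree's mandated layout (single-conjunct summit).
set_option linter.dupNamespace false

namespace Summit.KontsevichZagierPeriods.KontsevichZagierPeriods.Cruxes.ReductionRigidity.SplitR1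

open Set MeasureTheory
open Literature.NumberTheory.Transcendental
open Literature.NumberTheory.Transcendental.KZ hiding cubicalSpan
open Summit.KontsevichZagierPeriods.FurushoPentagon.ReducedPeriodRing (unitCube cubicalGens cubicalSpan)
open Summit.KontsevichZagierPeriods.FurushoPentagon.SectorToKernel (cubeRes_pi_Icc_eq_cube)
open Summit.KontsevichZagierPeriods.LiftingCriteria.CubeNashNormalFormDimLeOne (of_mem_of_dim_le_one)

/-- **`CubeResolution` in dimension `≤ 1`, unconditionally** (the item's statement with `N ≤ 1`).
[cite: KontsevichZagier2001, §1.2] [cite: ViuSos2021, Thm. 1.1] [folklore] -/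
theorem cubeResolution_dim_le_one {N : ℕ} (hN : N ≤ 1) (u : Literature.NumberTheory.Transcendental.KZ.IntegralRep N) :
    ∃ c ∈ AddSubgroup.closure {d : Literature.NumberTheory.Transcendental.KZ.FormalRep | ∃ (n : ℕ) (r : Literature.NumberTheory.Transcendental.KZ.IntegralRep n), r.domain = {x : Fin n → ℝ | ∀ i, 0 ≤ x i ∧ x i ≤ 1} ∧ AnalyticOnNhd ℝ r.integrand {x : Fin n → ℝ | ∀ i, 0 ≤ x i ∧ x i ≤ 1} ∧ d = Literature.NumberTheory.Transcendental.KZ.of r}, Literature.NumberTheory.Transcendental.KZ.of u - c ∈ Literature.NumberTheory.Transcendental.KZ.relations := by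
  -- the tame span (definitionally the tree's `cubicalSpan`) and the subgroup `relations ⊔ span`
  change ∃ c ∈ cubicalSpan, of u - c ∈ relations
  set M : AddSubgroup FormalRep := relations ⊔ cubicalSpan with hM
  -- every cube–Nash generator lies in `M` through its tame representative
  have hgen : ∀ {m : ℕ} (t : IntegralRep m) (g : (Fin m → ℝ) → ℝ) (U : Set (Fin m → ℝ)),
      IsOpen U → Set.pi Set.univ (fun _ : Fin m => Set.Icc (0:ℝ) 1) ⊆ U →
      IsSemialgebraicFunOn ℚ U g → AnalyticOnNhd ℝ g U →
      t.domain = Set.pi Set.univ (fun _ : Fin m => Set.Icc (0:ℝ) 1) →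
      (∀ z ∈ Set.pi Set.univ (fun _ : Fin m => Set.Icc (0:ℝ) 1), t.integrand z = g z) → of t ∈ M := by
    intro m t g U hU hsub hgs hga htd htg
    have hga' : AnalyticOnNhd ℝ g (KZ.cube m) := hga.mono (by rw [← cubeRes_pi_Icc_eq_cube]; exact hsub)
    have hgs' : IsSemialgebraicFunOn ℚ (KZ.cube m) g :=
      hgs.mono (by rw [← cubeRes_pi_Icc_eq_cube]; exact hsub) KZ.isSemialgebraic_cube
    set t' : IntegralRep m := IntegralRep.tameCube g hga' hgs' with ht'
    have htt' : of t - of t' ∈ relations := by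
      refine of_sub_of_mem_relations_of_eqOn ?_ ?_
      · rw [ht', IntegralRep.tameCube_domain, htd, cubeRes_pi_Icc_eq_cube]
      · intro z hz
        rw [htd] at hz
        rw [ht', IntegralRep.tameCube_integrand]
        exact htg z hz
    have ht'mem : of t' ∈ cubicalSpan :=
      AddSubgroup.subset_closure ⟨m, t', rfl, hga', rfl⟩
    have : of t = (of t - of t') + of t' := by abel
    rw [this]
    exact M.add_mem (AddSubgroup.mem_sup_left htt') (AddSubgroup.mem_sup_right ht'mem)
  have hu : of u ∈ M := of_mem_of_dim_le_one M le_sup_left hgen hN u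
  rw [hM, AddSubgroup.mem_sup] at hu
  obtain ⟨y, hy, z, hz, hyz⟩ := hu
  refine ⟨z, hz, ?_⟩
  have : of u - z = y := by rw [← hyz]; abel
  rw [this]
  exact hy

end Summit.KontsevichZagierPeriods.KontsevichZagierPeriods.Cruxes.ReductionRigidity.SplitR1
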